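import Summits.HodgeConjecture.HodgeConjecture.Theorems.WeilTenfoldsSqrtMinus11.Negative.EigenvalueSeparation
import Summits.HodgeConjecture.HodgeConjecture.Theorems.WeilTenfoldsSqrtMinus11.Negative.WeilPlaneKernel

/-!
# `WeilTenfoldsSqrtMinus11` (stmt-HodgeConjecture-1262) · Negative · the integers of the descent projector

Negative-side knowledge for the crux `HeckePrymWeil.WeilTenfoldsSqrtMinus11`, from the standing disprover's work
file `Cruxes/WeilTenfoldsSqrtMinus11/Disproof.lean` §D (refuter-cdisprove-stmt-HodgeConjecture-1262-g3-0, cycle 3,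
2026-08-16). The stub `stub_descent` of the picked line `generic-ppav-secant-descent` (Schoen's descent `12 → 10`
for one partner surface, single-operator typing) splits `P = pr_A^* c ⌣ pr_B^*(b₊ + b₋)` by the projector
`q(T)`, `T = (𝟙 + φ × φ_B)^*`, `q(X) = (X - μ₁)(X - μ₂)` with the two MIXED product eigenvalues
`μ₁ = λ₊¹⁰λ₋²`, `μ₂ = λ₊²λ₋¹⁰` (`λ± = 1 ± i√11`), and needs (i) `q ∈ ℤ[X]` (so that `q(T)P`, `Tq(T)P` are
rational `(6,6)` classes to which the twelvefold hypothesis applies) and (ii) `q(λ±¹²) ≠ 0` (so that the `2×2`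
inversion recovers `P₊₊`, `P₋₋`). Both are checked here: `μ₁ = -2082816 - 645120·i√11`, `μ₂ = μ̄₁`
(`mixed_ten_two_eq`, `mixed_two_ten_eq`), `μ₁ + μ₂ = -4165632`, `μ₁μ₂ = 12¹² = 8916100448256`
(`mixedPair_sum_eq`, `mixedPair_mul_eq`), `q(λ₊¹²) ≠ 0 ≠ q(λ₋¹²)` (`projector_ne_zero_at_plus/_minus`, from the
landed eigenvalue separation `weil_mixed_ne_plus/minus`). Pure arithmetic; no new definition.
-/

noncomputable section

namespace Summit.HodgeConjecture.HodgeConjecture.Theorems.WeilTenfoldsSqrtMinus11.Negative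

open Complex

/-! ### The integers behind `q(T)` -/


/-- `weilXY 11 2 = (-10, 2)`: `(1 + i√11)² = -10 + 2i√11`. [folklore] -/
theorem weilXY_eleven_two : weilXY 11 2 = (-10, 2) := by decide

/-- `weilXY 11 12 = (-2781184, 327680)`: `(1 + i√11)¹² = -2781184 + 327680 i√11`. [folklore] -/
theorem weilXY_eleven_twelve : weilXY 11 12 = (-2781184, 327680) := by decide

/-- `(i√11)² = -11` with the coercion spelled `((√11 : ℝ) : ℂ)`. [folklore] -/
theorem I_mul_sqrt_eleven_sq : (I * ((Real.sqrt (11 : ℝ) : ℝ) : ℂ)) ^ 2 = -11 := by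
  have := I_mul_sqrt_sq 11
  push_cast at this
  simpa using this

/-- `λ₊¹⁰ λ₋² = -2082816 - 645120 i√11` (a MIXED product eigenvalue of `(𝟙 + φ × φ_B)^*` on
`pr_A^* H¹⁰ ⌣ pr_B^* H²`). [folklore] -/
theorem mixed_ten_two_eq :
    (1 + I * ((Real.sqrt (11 : ℝ) : ℝ) : ℂ)) ^ 10 * (1 - I * ((Real.sqrt (11 : ℝ) : ℝ) : ℂ)) ^ 2 =
      -2082816 - 645120 * (I * ((Real.sqrt (11 : ℝ) : ℝ) : ℂ)) := by
  have h10 := one_add_pow_eq 11 (I * ((Real.sqrt (11 : ℝ) : ℝ) : ℂ)) (by exact_mod_cast I_mul_sqrt_eleven_sq) 10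
  have h2 := one_sub_pow_eq 11 (I * ((Real.sqrt (11 : ℝ) : ℝ) : ℂ)) (by exact_mod_cast I_mul_sqrt_eleven_sq) 2
  rw [weilXY_eleven_ten] at h10
  rw [weilXY_eleven_two] at h2
  push_cast at h10 h2
  rw [h10, h2]
  linear_combination (-31744 : ℂ) * I_mul_sqrt_eleven_sq

/-- `λ₊² λ₋¹⁰ = -2082816 + 645120 i√11`. [folklore] -/
theorem mixed_two_ten_eq :
    (1 + I * ((Real.sqrt (11 : ℝ) : ℝ) : ℂ)) ^ 2 * (1 - I * ((Real.sqrt (11 : ℝ) : ℝ) : ℂ)) ^ 10 =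
      -2082816 + 645120 * (I * ((Real.sqrt (11 : ℝ) : ℝ) : ℂ)) := by
  have h2 := one_add_pow_eq 11 (I * ((Real.sqrt (11 : ℝ) : ℝ) : ℂ)) (by exact_mod_cast I_mul_sqrt_eleven_sq) 2
  have h10 := one_sub_pow_eq 11 (I * ((Real.sqrt (11 : ℝ) : ℝ) : ℂ)) (by exact_mod_cast I_mul_sqrt_eleven_sq) 10
  rw [weilXY_eleven_ten] at h10
  rw [weilXY_eleven_two] at h2
  push_cast at h10 h2
  rw [h10, h2]
  linear_combination (-31744 : ℂ) * I_mul_sqrt_eleven_sq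

/-- **The projector polynomial of `stub_descent` has INTEGER coefficients**: `μ₁ + μ₂ = -4165632` for the two
mixed product eigenvalues, so `q(X) = (X - μ₁)(X - μ₂) = X² + 4165632·X + 12¹² ∈ ℤ[X]` and `q(T)P`, `T q(T) P`
are rational classes whenever `P` is. [folklore] -/
theorem mixedPair_sum_eq :
    (1 + I * ((Real.sqrt (11 : ℝ) : ℝ) : ℂ)) ^ 10 * (1 - I * ((Real.sqrt (11 : ℝ) : ℝ) : ℂ)) ^ 2 +
      (1 + I * ((Real.sqrt (11 : ℝ) : ℝ) : ℂ)) ^ 2 * (1 - I * ((Real.sqrt (11 : ℝ) : ℝ) : ℂ)) ^ 10 =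
      -4165632 := by
  rw [mixed_ten_two_eq, mixed_two_ten_eq]; ring

/-- `μ₁ μ₂ = 12¹² = 8916100448256`. [folklore] -/
theorem mixedPair_mul_eq :
    ((1 + I * ((Real.sqrt (11 : ℝ) : ℝ) : ℂ)) ^ 10 * (1 - I * ((Real.sqrt (11 : ℝ) : ℝ) : ℂ)) ^ 2) *
      ((1 + I * ((Real.sqrt (11 : ℝ) : ℝ) : ℂ)) ^ 2 * (1 - I * ((Real.sqrt (11 : ℝ) : ℝ) : ℂ)) ^ 10) =
      8916100448256 := by
  rw [mixed_ten_two_eq, mixed_two_ten_eq]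
  linear_combination (-416179814400 : ℂ) * I_mul_sqrt_eleven_sq

/-- `q` does not vanish at the PURE eigenvalue `λ₊¹²` (the `2×2` inversion recovers `P₊₊`). [folklore] -/
theorem projector_ne_zero_at_plus :
    ((1 + I * ((Real.sqrt (11 : ℝ) : ℝ) : ℂ)) ^ 12 -
        (1 + I * ((Real.sqrt (11 : ℝ) : ℝ) : ℂ)) ^ 10 * (1 - I * ((Real.sqrt (11 : ℝ) : ℝ) : ℂ)) ^ 2) *
      ((1 + I * ((Real.sqrt (11 : ℝ) : ℝ) : ℂ)) ^ 12 -
        (1 + I * ((Real.sqrt (11 : ℝ) : ℝ) : ℂ)) ^ 2 * (1 - I * ((Real.sqrt (11 : ℝ) : ℝ) : ℂ)) ^ 10) ≠ 0 := by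
  have h1 : (1 + I * ((Real.sqrt (11 : ℝ) : ℝ) : ℂ)) ^ 10 * (1 - I * ((Real.sqrt (11 : ℝ) : ℝ) : ℂ)) ^ 2 ≠
      (1 + I * ((Real.sqrt (11 : ℝ) : ℝ) : ℂ)) ^ 12 := by
    have := weil_mixed_ne_plus (p := 11) (by norm_num) (by norm_num) (a := 10) (b := 2) (m := 12)
      (by norm_num) (by norm_num)
    exact_mod_cast this
  have h2 : (1 + I * ((Real.sqrt (11 : ℝ) : ℝ) : ℂ)) ^ 2 * (1 - I * ((Real.sqrt (11 : ℝ) : ℝ) : ℂ)) ^ 10 ≠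
      (1 + I * ((Real.sqrt (11 : ℝ) : ℝ) : ℂ)) ^ 12 := by
    have := weil_mixed_ne_plus (p := 11) (by norm_num) (by norm_num) (a := 2) (b := 10) (m := 12)
      (by norm_num) (by norm_num)
    exact_mod_cast this
  exact mul_ne_zero (sub_ne_zero.2 (Ne.symm h1)) (sub_ne_zero.2 (Ne.symm h2))

/-- … nor at `λ₋¹²` (recovers `P₋₋`). [folklore] -/
theorem projector_ne_zero_at_minus :
    ((1 - I * ((Real.sqrt (11 : ℝ) : ℝ) : ℂ)) ^ 12 -
        (1 + I * ((Real.sqrt (11 : ℝ) : ℝ) : ℂ)) ^ 10 * (1 - I * ((Real.sqrt (11 : ℝ) : ℝ) : ℂ)) ^ 2) *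
      ((1 - I * ((Real.sqrt (11 : ℝ) : ℝ) : ℂ)) ^ 12 -
        (1 + I * ((Real.sqrt (11 : ℝ) : ℝ) : ℂ)) ^ 2 * (1 - I * ((Real.sqrt (11 : ℝ) : ℝ) : ℂ)) ^ 10) ≠ 0 := by
  have h1 : (1 + I * ((Real.sqrt (11 : ℝ) : ℝ) : ℂ)) ^ 10 * (1 - I * ((Real.sqrt (11 : ℝ) : ℝ) : ℂ)) ^ 2 ≠
      (1 - I * ((Real.sqrt (11 : ℝ) : ℝ) : ℂ)) ^ 12 := by
    have := weil_mixed_ne_minus (p := 11) (by norm_num) (by norm_num) (a := 10) (b := 2) (m := 12)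
      (by norm_num) (by norm_num)
    exact_mod_cast this
  have h2 : (1 + I * ((Real.sqrt (11 : ℝ) : ℝ) : ℂ)) ^ 2 * (1 - I * ((Real.sqrt (11 : ℝ) : ℝ) : ℂ)) ^ 10 ≠
      (1 - I * ((Real.sqrt (11 : ℝ) : ℝ) : ℂ)) ^ 12 := by
    have := weil_mixed_ne_minus (p := 11) (by norm_num) (by norm_num) (a := 2) (b := 10) (m := 12)
      (by norm_num) (by norm_num)
    exact_mod_cast this
  exact mul_ne_zero (sub_ne_zero.2 (Ne.symm h1)) (sub_ne_zero.2 (Ne.symm h2))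

end Summit.HodgeConjecture.HodgeConjecture.Theorems.WeilTenfoldsSqrtMinus11.Negative

end
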